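import Literature.NumberTheory.DiophantineGeometry.PlaneCurveLocalisation
import HarnessLib

/-!
# Conductor versus multiplicity on a fixed affine curve: at a good prime, a section vanishing to
# order `k` along the divisor `V(f, G)` has `ord_w ≥ k` wherever the point meets the divisor

Topic `Literature/NumberTheory/DiophantineGeometry`; composition of the two theorems of
`PlaneCurveLocalisation.lean` (Bombieri–Gubler, *Heights in Diophantine Geometry* (2006), Lemma 2.2.9
(2.1), Lemma 2.2.10 and Remark 2.2.13 — "the list of elements `p_a` so obtained and the degree `d`
depend only on the geometric data … but not on `E`, nor on the absolute value": the non-archimedean,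
good-reduction form). Let `K` be a number field, `f, G ∈ K[X_σ]` (`σ` finite), `Δ ⊆ K^σ` a finite set
containing all common zeros of `f` and `G` in an algebraically closed field `Ω ⊇ K`, and `R ∈ K[X_σ]`
with `R ∈ (f) + 𝔪_P^k` for every `P ∈ Δ` (`𝔪_P = ⟨X_i − P_i⟩`; e.g. the section produced by
`PlaneCurve.exists_totalDegree_le_notMem_span'` of `PlaneCurveSections.lean`). Then ONE nonzero
`d ∈ 𝓞 K` works for all three steps at once:

* `exists_den_valuation_le_pow_of_commonZeros` — for every field `L ⊇ K`, every valuation `v` on `L`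
  with `v ≤ 1` on `𝓞 K` and `v(d) = 1`, every `v`-integral point `y` of `f = 0` with `v(G(y)) < 1`, and
  every `μ` bounding all valuations `< 1` from above: `v(R(y)) ≤ μ^k`;
* `exists_den_finitePlace_le_pow_of_commonZeros` — the number-field form: for the finite places `w` of
  a number field `L ⊇ K` not dividing `d`, `w`-integral `y` on `f = 0` with `w(G(y)) < 1` ("`y` meets
  the reduced divisor `V(f, G)` at `w`") have `w(R(y)) ≤ ϖ_w^k`, i.e. `ord_w R(y) ≥ k`
  (`HeightOneSpectrum.valuation`, value `Multiplicative.ofAdd (−k)`).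

This is the local inequality behind the sharp form of [GenEll] Prop. 1.6 (S. Mochizuki, Math. J.
Okayama Univ. 52 (2010)) on a fixed curve: summed over the good places it gives
`k · Σ_{w good, w | G(y)} log N(w) ≤ Σ_w ord_w⁺ R(y) · log N(w)`. No `def` is declared; nothing here
refers to a disputed claim (abc-iut cell, support item GenEllTwo = stmt-ABC-19679).
-/

noncomputable section

namespace Literature.NumberTheory.DiophantineGeometry.PlaneCurve

open MvPolynomial NumberField

universe u v w

/-! ### Two small order lemmas -/

section Order

variable {Γ₀ : Type*} [LinearOrderedCommGroupWithZero Γ₀]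

/-- If `a, b ≤ 1` and `a·b = 1` then `a = 1` (and `b = 1`): plumbing for splitting the condition
"`v(d₁ d₂ ⋯) = 1`" at a good prime. [folklore] -/
private theorem eq_one_of_le_one_of_mul_eq_one {a b : Γ₀} (ha : a ≤ 1) (hb : b ≤ 1) (h : a * b = 1) :
    a = 1 := by
  by_contra hne
  have hlt : a < 1 := lt_of_le_of_ne ha hne
  have : a * b < 1 := by
    calc a * b ≤ a * 1 := mul_le_mul' le_rfl hb
      _ = a := mul_one a
      _ < 1 := hlt
  exact this.ne h

end Order

/-- In `ℤₘ₀`, an element `< 1` is `≤ ofAdd (−1)` ("valuation `< 1`" means "order `≥ 1`"): plumbing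
for discrete valuations. [folklore] -/
private theorem WithZero.le_ofAdd_neg_one_of_lt_one {x : WithZero (Multiplicative ℤ)} (hx : x < 1) :
    x ≤ ((Multiplicative.ofAdd (-1 : ℤ) : Multiplicative ℤ) : WithZero (Multiplicative ℤ)) := by
  induction x using WithZero.recZeroCoe with
  | zero => exact zero_le
  | coe a =>
    rw [← WithZero.coe_one, WithZero.coe_lt_coe] at hx
    rw [WithZero.coe_le_coe]
    change Multiplicative.toAdd a ≤ -1
    have : Multiplicative.toAdd a < 0 := hx
    omega

/-! ### The composition -/

section Main

variable {K : Type u} [Field K] [NumberField K] {σ : Type w} [Fintype σ]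
variable {Ω : Type*} [Field Ω] [Algebra K Ω] [IsAlgClosed Ω]

/-- **Multiplicity along a divisor at a good prime (valuation form).** Let `Δ ⊇ V(f, G)(Ω)` be a finite
set of `K`-points and `R ∈ (f) + 𝔪_P^k` for every `P ∈ Δ`. Then there is a nonzero `d ∈ 𝓞 K` such
that for every field `L ⊇ K`, every valuation `v` on `L` with `v ≤ 1` on `𝓞 K` and `v(d) = 1`, every
`v`-integral point `y` of `f = 0` with `v(G(y)) < 1`, and every `μ` with `v(x) < 1 → v(x) ≤ μ`:
`v(R(y)) ≤ μ^k`. (Composition of the good-prime localisation — `y` reduces onto some `P ∈ Δ` — with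
the multiplicity inequality at `P`; one `d` clears the denominators of both Nullstellensatz/ideal
representations, "independent of the place".)
[cite: BombieriGubler2006, Lemma 2.2.10 with Remark 2.2.13 (non-archimedean, good reduction)] -/
theorem exists_den_valuation_le_pow_of_commonZeros (f G R : MvPolynomial σ K) (Δ : Finset (σ → K))
    (k : ℕ)
    (hΔ : ∀ z : σ → Ω, aeval z f = 0 → aeval z G = 0 → ∃ P ∈ Δ, ∀ i, z i = algebraMap K Ω (P i))
    (hR : ∀ P ∈ Δ, R ∈ Ideal.span {f} ⊔ Ideal.span (Set.range fun i : σ => X i - C (P i)) ^ k) :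
    ∃ d : 𝓞 K, d ≠ 0 ∧
      ∀ (L : Type v) [Field L] [Algebra K L] (Γ₀ : Type) [LinearOrderedCommGroupWithZero Γ₀]
        (v : Valuation L Γ₀), (∀ r : 𝓞 K, v (algebraMap (𝓞 K) L r) ≤ 1) →
        v (algebraMap (𝓞 K) L d) = 1 →
        ∀ y : σ → L, (∀ i, v (y i) ≤ 1) → aeval y f = 0 → v (aeval y G) < 1 →
        ∀ μ : Γ₀, (∀ x : L, v x < 1 → v x ≤ μ) → v (aeval y R) ≤ μ ^ k := by
  classical
  obtain ⟨d₁, hd₁0, hd₁⟩ := exists_den_localisation.{u, v, w} (Ω := Ω) f G Δ hΔ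
  choose dP hdP0 hdP using
    fun P : ↥Δ => exists_den_valuation_le_pow.{u, v, w} f R (P : σ → K) k (hR P P.2)
  refine ⟨d₁ * ∏ P : ↥Δ, dP P, mul_ne_zero hd₁0 (Finset.prod_ne_zero_iff.2 fun P _ => hdP0 P), ?_⟩
  intro L _ _ Γ₀ _ v hv hvd y hy hf hG μ hμ
  -- at a good prime of `d`, every factor has valuation `1`
  rw [map_mul, map_prod, map_mul, map_prod] at hvd
  have h1 : v (algebraMap (𝓞 K) L d₁) = 1 :=
    eq_one_of_le_one_of_mul_eq_one (hv d₁) (Finset.prod_le_one' fun P _ => hv (dP P)) hvd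
  have h2 : ∀ P : ↥Δ, v (algebraMap (𝓞 K) L (dP P)) = 1 := by
    rw [h1, one_mul] at hvd
    exact fun P => (Finset.prod_eq_one_iff_of_le_one' fun Q _ => hv (dP Q)).1 hvd P (Finset.mem_univ P)
  -- localise at `P`, then apply the multiplicity inequality at `P`
  obtain ⟨P, hP, hyP⟩ := hd₁ L Γ₀ v hv h1 y hy hf hG
  exact hdP ⟨P, hP⟩ L Γ₀ v hv (h2 ⟨P, hP⟩) y hy hf μ fun i => hμ _ (hyP i)

/-- **Multiplicity along a divisor at a good prime (number-field form).** As
`exists_den_valuation_le_pow_of_commonZeros`, for the finite places `w` of a number field `L ⊇ K`: at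
every `w` not dividing `d`, every `w`-integral point `y` of `f = 0` with `w(G(y)) < 1` has
`w(R(y)) ≤ ofAdd(−k)`, i.e. `ord_w R(y) ≥ k`. Summed over the good places with weights `log N(w)` this
is `k · #{w good : y meets V(f,G) at w}_{log N} ≤ Σ_w ord_w⁺ R(y) log N(w)`, the local-to-global step
of the conductor–height comparison on a fixed curve.
[cite: BombieriGubler2006, Lemma 2.2.10 with Remark 2.2.13 (non-archimedean, good reduction)] -/
theorem exists_den_finitePlace_le_pow_of_commonZeros (f G R : MvPolynomial σ K)
    (Δ : Finset (σ → K)) (k : ℕ)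
    (hΔ : ∀ z : σ → Ω, aeval z f = 0 → aeval z G = 0 → ∃ P ∈ Δ, ∀ i, z i = algebraMap K Ω (P i))
    (hR : ∀ P ∈ Δ, R ∈ Ideal.span {f} ⊔ Ideal.span (Set.range fun i : σ => X i - C (P i)) ^ k) :
    ∃ d : 𝓞 K, d ≠ 0 ∧
      ∀ (L : Type v) [Field L] [NumberField L] [Algebra K L]
        (w : IsDedekindDomain.HeightOneSpectrum (𝓞 L)),
        w.valuation L (algebraMap (𝓞 K) L d) = 1 →
        ∀ y : σ → L, (∀ i, w.valuation L (y i) ≤ 1) → aeval y f = 0 →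
          w.valuation L (aeval y G) < 1 →
          w.valuation L (aeval y R) ≤
            ((Multiplicative.ofAdd (-(k : ℤ)) : Multiplicative ℤ) : WithZero (Multiplicative ℤ)) := by
  obtain ⟨d, hd0, hd⟩ := exists_den_valuation_le_pow_of_commonZeros.{u, v, w} (Ω := Ω) f G R Δ k hΔ hR
  refine ⟨d, hd0, fun L _ _ _ w hwd y hy hf hG => ?_⟩
  have hv : ∀ r : 𝓞 K, w.valuation L (algebraMap (𝓞 K) L r) ≤ 1 := fun r => by
    rw [IsScalarTower.algebraMap_apply (𝓞 K) (𝓞 L) L]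
    exact IsDedekindDomain.HeightOneSpectrum.valuation_le_one _ _
  have h := hd L _ (w.valuation L) hv hwd y hy hf hG
    ((Multiplicative.ofAdd (-1 : ℤ) : Multiplicative ℤ) : WithZero (Multiplicative ℤ))
    (fun x hx => WithZero.le_ofAdd_neg_one_of_lt_one hx)
  rwa [← WithZero.coe_pow, ← ofAdd_nsmul, nsmul_eq_mul, mul_neg, mul_one] at h

end Main

end Literature.NumberTheory.DiophantineGeometry.PlaneCurve
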